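import Summits.HodgeConjecture.CorCM.GaloisSixteenGood
import Summits.HodgeConjecture.CorCM.GaloisSixteenStructureB
import Summits.HodgeConjecture.CorCM.GaloisSixteenTableLawsE
import Summits.HodgeConjecture.CorCM.GaloisSixteenDegenerateTablesC
import Summits.HodgeConjecture.CorCM.GaloisSixteenDegenerateTablesE30
import Summits.HodgeConjecture.CorCM.GaloisSixteenDegenerateTablesE11
import Summits.HodgeConjecture.CorCM.GaloisSixteenDegenerateTablesE31
import HarnessLib

/-!
# Galois CM fields of degree `16`: THE CLASSIFICATION — all simple CM eightfolds are nondegenerate iff `GOOD16`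

COR-CM (cell `pub-hodgecm2`), binder seat b04 (gen 17), count-neutral claim GALOIS16-COMPLETE, necessity half and the
equivalence.  KERNEL ONLY: theorems; no definition, no named fact, no `sorry`.  `HC_CM` is neither used nor claimed.

**THEOREM (`forall_isPrimitive_isNondegenerate_iff_good16`).**  Let `K` be a Galois CM field of degree `16` with
Galois group `G` and complex conjugation `c`.  Then every primitive CM type of `K` is nondegenerate (equivalently,
`forall_isSimple_isNondegenerate_iff_good16`: every SIMPLE abelian variety with complex multiplication by `K` is
nondegenerate, so that the Hodge ring of all its powers is generated by divisors) **if and only if**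

  `GOOD16(G, c)`:  (∀ g, g² ∈ {1, c})  ∨  (∃ r of order 8 with r⁴ = c and g r g⁻¹ ∈ {r, r⁻¹} for all g).

Of the `14` groups of order `16` with their central involutions this selects `C₁₆`, `C₈ × C₂` (`c = (4,0)`), `C₂⁴`,
`C₄ × C₂²` (`c` a square), `D₄ × C₂` (`c = r²`), `Q₈ × C₂` (`c = a²`), `C₄ ∘ D₄`, `D₁₆`, `Q₁₆`; in every other case —
`C₈ × C₂` (other `c`), `C₄ × C₄`, `C₄ × C₂²` (`c` not a square), `SD₁₆`, `M₁₆`, `C₄ ⋊ C₄`, `(C₄ × C₂) ⋊ C₂`, and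
`D₄ × C₂`, `Q₈ × C₂` with `c` outside the square class — `K` has a primitive DEGENERATE CM type, realised by a simple
CM eightfold with an exceptional Hodge class on some power (`exists_isPrimitive_not_isNondegenerate_of_not_good16`).

Necessity is assembled from: commutative `G` — gen 16's `AbelianTwoPowerClassification`; an element of order `8` —
`structure_of_orderOf_eq_eight` + law A + the null-certificate tables `(3,4)`, `(5,2)`, `(5,4)`, `(5,6)`
(`GaloisSixteenDegenerateTablesC`; the presentations with `s² = 1` are first moved to `s ↦ s r`); exponent `4` —
`structure_of_pow_four` + law E + the twelve tables of `GaloisSixteenDegenerateTablesE30/E11/E31`.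

## References

* [Dodson1984] B. Dodson, *The structure of Galois groups of CM-fields*, Trans. AMS 283 (1984), §3.3, §5.2, §5.3.1.
* [Dodson1987] B. Dodson, J. Algebra 111 (1987), §1.1 p. 50.
* [Shimura1998] G. Shimura, *Abelian Varieties with Complex Multiplication and Modular Functions*, §6.2 Thm. 3,
  §8.2 Prop. 26.
* [Gordon1999HodgeAVSurvey] B. B. Gordon, *A survey of the Hodge conjecture for abelian varieties*, Thm. 6.4, §9.4.
-/

noncomputable section

open CategoryTheory CategoryTheory.Limits NumberField

namespace Summit.HodgeConjecture.CorCM.GaloisSixteenClassification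

open Literature.NumberTheory.ComplexMultiplication
open Literature.AlgebraicGeometry.Motives (AbelianVariety CMType)
open Literature.AlgebraicGeometry.HodgeTheory
open Literature.AlgebraicGeometry.ComplexMultiplication (IsCMTypeRealisation isSimple_iff_isPrimitive)
open Literature.AlgebraicGeometry.Pohlmann1968
open Literature.Barriers.HodgeConjecture (divisorClassesSpan)
open Summit.HodgeConjecture.CorCM.GaloisTableLaws
open Summit.HodgeConjecture.CorCM.GaloisSixteenStructure
open Summit.HodgeConjecture.CorCM.GaloisSixteenDegenerate

open scoped Classical

variable {K : Type} [Field K] [NumberField K] [IsCMField K] [IsGalois ℚ K]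

/-! ## §1 Small tools -/

omit [IsCMField K] [IsGalois ℚ K] in
/-- Primitivity does not depend on the base embedding. [cite: Shimura1998, §8.2 Prop. 26] -/
theorem isPrimitive_of_isPrimitive {Φ : CMType K} {φ₁ : K →+* ℂ} (h : IsPrimitive (ℂ ≃+* ℂ) Φ.1 φ₁)
    (φ₀ : K →+* ℂ) : IsPrimitive (ℂ ≃+* ℂ) Φ.1 φ₀ := by
  haveI := isPretransitive_ringEquiv_complex (K := K)
  exact (isPrimitive_iff_forall_eq Φ.1 φ₀).2 ((isPrimitive_iff_forall_eq Φ.1 φ₁).1 h)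

omit [IsCMField K] [IsGalois ℚ K] in
/-- Read a packaged "simple degenerate eightfold" statement as a primitive degenerate type for a given base
embedding. [folklore] -/
theorem primdeg_of_exists
    (h : ∃ (Φ : CMType K) (φ₀ : K →+* ℂ) (A : AbelianVariety ℂ) (ι : 𝓞 K →+* End A)
      (θ : K →+* Module.End ℂ (complexBetti A.X 1)),
      IsPrimitive (ℂ ≃+* ℂ) Φ.1 φ₀ ∧ ¬ IsNondegenerate Φ ∧ IsCMTypeRealisation Φ A ι θ ∧ A.IsSimple ∧
      A.dim = Module.finrank ℚ K / 2 ∧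
      ∃ n p : ℕ, ∃ x : complexBetti (⨁ fun _ : Fin n => A).X (2 * p), IsRationalClass x ∧
        IsOfHodgeType (⨁ fun _ : Fin n => A).dim (⨁ fun _ : Fin n => A).X (2 * p) p p x ∧
        x ∉ divisorClassesSpan (⨁ fun _ : Fin n => A).X (⨁ fun _ : Fin n => A).dim p)
    (φ₀ : K →+* ℂ) : ∃ Φ : CMType K, IsPrimitive (ℂ ≃+* ℂ) Φ.1 φ₀ ∧ ¬ IsNondegenerate Φ := by
  obtain ⟨Φ, φ₁, -, -, -, hprim, hdeg, -⟩ := h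
  exact ⟨Φ, isPrimitive_of_isPrimitive hprim φ₀, hdeg⟩

/-- If a group of order `16` has no element of order `8` and is not commutative, every element satisfies `u⁴ = 1`.
[folklore] -/
theorem pow_four_eq_one_of_no_eight {G : Type*} [Group G] [Finite G] (hcard : Nat.card G = 16)
    (h8 : ¬ ∃ r : G, orderOf r = 8) (a b : G) (hab : a * b ≠ b * a) (u : G) : u ^ 4 = 1 := by
  have hdvd : orderOf u ∣ 16 := hcard ▸ orderOf_dvd_natCard u
  have hle : orderOf u ≤ 16 := Nat.le_of_dvd (by norm_num) hdvd
  have hne8 : orderOf u ≠ 8 := fun h => h8 ⟨u, h⟩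
  have hne16 : orderOf u ≠ 16 := by
    intro h16
    have htop : Subgroup.zpowers u = ⊤ :=
      Subgroup.eq_top_of_card_eq _ (by rw [Nat.card_zpowers, h16, hcard])
    have hmem : ∀ v : G, v ∈ Subgroup.zpowers u := fun v => htop ▸ Subgroup.mem_top v
    obtain ⟨i, -, rfl⟩ := exists_pow_lt_of_mem_zpowers (hmem a)
    obtain ⟨j, -, rfl⟩ := exists_pow_lt_of_mem_zpowers (hmem b)
    exact hab (Commute.pow_pow (Commute.refl u) i j).eq
  apply orderOf_dvd_iff_pow_eq_one.1
  interval_cases h : orderOf u <;> omega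

/-- Moving `s` to `s r` in law A: from `s r = r^μ s`, `s² = 1` (`r⁸ = 1`) get `(s r) r = r^μ (s r)` and
`(s r)² = r^{(μ² + μ) mod 8}`. [folklore] -/
theorem shift_s {G : Type*} [Group G] (r s : G) (μ : ℕ) (hr8 : r ^ 8 = 1) (hsr : s * r = r ^ μ * s)
    (hss : s * s = 1) : (s * r) * r = r ^ μ * (s * r) ∧ (s * r) * (s * r) = r ^ ((μ * μ + μ) % 8) := by
  constructor
  · calc s * r * r = s * r ^ 2 := by rw [mul_assoc, pow_two]
      _ = r ^ (μ * 2) * s := s_mul_pow r s μ hsr 2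
      _ = r ^ μ * (r ^ μ * s) := by rw [show μ * 2 = μ + μ by ring, pow_add, mul_assoc]
      _ = r ^ μ * (s * r) := by rw [← hsr]
  · calc s * r * (s * r) = (r ^ μ * s) * (r ^ μ * s) := by rw [hsr]
      _ = r ^ μ * (s * r ^ μ) * s := by simp only [mul_assoc]
      _ = r ^ μ * (r ^ (μ * μ) * s) * s := by rw [s_mul_pow r s μ hsr μ]
      _ = r ^ (μ + μ * μ) * (s * s) := by rw [pow_add]; simp only [mul_assoc]
      _ = r ^ ((μ * μ + μ) % 8) := by
        rw [hss, mul_one, pow_eq_pow_of_mod_eq r hr8 (a := μ + μ * μ) (b := (μ * μ + μ) % 8)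
          (by rw [Nat.mod_mod, Nat.add_comm])]

/-! ## §2 Necessity: not `GOOD16` ⟹ a primitive degenerate CM type -/

/-- **¬GOOD16 ⟹ `K` has a PRIMITIVE DEGENERATE CM type** (for any base embedding). [cite: Shimura1998, §8.2 Prop. 26]
[cite: Gordon1999HodgeAVSurvey, Thm. 6.4] [cite: Dodson1987, §1.1 (p. 50)] -/
theorem exists_isPrimitive_not_isNondegenerate_of_not_good16 (hK : Module.finrank ℚ K = 16)
    (hng : ¬ ((∀ g : K ≃ₐ[ℚ] K, g * g = 1 ∨ g * g = (IsCMField.complexConj K).restrictScalars ℚ) ∨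
      (∃ r : K ≃ₐ[ℚ] K, orderOf r = 8 ∧ r ^ 4 = (IsCMField.complexConj K).restrictScalars ℚ ∧
        ∀ g : K ≃ₐ[ℚ] K, g * r * g⁻¹ = r ∨ g * r * g⁻¹ = r⁻¹)))
    (φ₀ : K →+* ℂ) : ∃ Φ : CMType K, IsPrimitive (ℂ ≃+* ℂ) Φ.1 φ₀ ∧ ¬ IsNondegenerate Φ := by
  obtain ⟨hcard, hc1, hcc, hcz⟩ := gal_facts hK
  set c : K ≃ₐ[ℚ] K := (IsCMField.complexConj K).restrictScalars ℚ with hc_def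
  have h16 : Module.finrank ℚ K = 2 ^ (3 + 1) := by rw [hK]; norm_num
  -- the unique involution of a cyclic group `⟨z⟩` containing `c`
  have hinv8 : ∀ z : K ≃ₐ[ℚ] K, orderOf z = 8 → c ∈ Subgroup.zpowers z → z ^ 4 = c := by
    intro z hz hcz'
    obtain ⟨k, hk, hck⟩ := exists_pow_lt_of_mem_zpowers hcz'
    rw [hz] at hk
    have h2k : z ^ (k + k) = 1 := by rw [pow_add, ← hck, hcc]
    have hdvd := orderOf_dvd_of_pow_eq_one h2k
    rw [hz] at hdvd
    have hk4 : k = 4 := by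
      rcases (show k = 0 ∨ k = 4 by omega) with rfl | rfl
      · exact absurd (by rw [hck, pow_zero]) hc1
      · rfl
    rw [hck, hk4]
  by_cases hcomm : ∀ a b : K ≃ₐ[ℚ] K, a * b = b * a
  · -- commutative Galois group: gen 16
    refine AbelianTwoPowerClassification.exists_isPrimitive_not_isNondegenerate_of_not_good hcomm h16 ?_
      (by rw [hK]; norm_num) (fun h => hng (Or.inl h.2)) φ₀
    rintro ⟨z, hcz', hidx⟩
    change c ∈ Subgroup.zpowers z at hcz'
    apply hng
    right
    have hprod := (Subgroup.zpowers z).index_mul_card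
    rw [Nat.card_zpowers, hcard] at hprod
    have hconj : ∀ r g : K ≃ₐ[ℚ] K, g * r * g⁻¹ = r ∨ g * r * g⁻¹ = r⁻¹ := fun r g =>
      Or.inl (by rw [hcomm g r, mul_inv_cancel_right])
    rcases (show (Subgroup.zpowers z).index = 0 ∨ (Subgroup.zpowers z).index = 1 ∨
        (Subgroup.zpowers z).index = 2 by omega) with h | h | h <;> rw [h] at hprod
    · omega
    · -- `orderOf z = 16`: take `r = z²`
      have hz : orderOf z = 16 := by omega
      have hr : orderOf (z ^ 2) = 8 := by rw [orderOf_pow' z (by norm_num), hz]; norm_num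
      refine ⟨z ^ 2, hr, ?_, hconj _⟩
      obtain ⟨k, hk, hck⟩ := exists_pow_lt_of_mem_zpowers hcz'
      rw [hz] at hk
      have h2k : z ^ (k + k) = 1 := by rw [pow_add, ← hck, hcc]
      have hdvd := orderOf_dvd_of_pow_eq_one h2k
      rw [hz] at hdvd
      have hk8 : k = 8 := by
        rcases (show k = 0 ∨ k = 8 by omega) with rfl | rfl
        · exact absurd (by rw [hck, pow_zero]) hc1
        · rfl
      rw [← pow_mul, hck, hk8]
    · -- `orderOf z = 8`: take `r = z`
      have hz : orderOf z = 8 := by omega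
      exact ⟨z, hz, hinv8 z hz hcz', hconj _⟩
  -- non-commutative Galois group
  simp only [not_forall] at hcomm
  obtain ⟨a, b, hab⟩ := hcomm
  by_cases h8 : ∃ r : K ≃ₐ[ℚ] K, orderOf r = 8
  · obtain ⟨r, hr⟩ := h8
    have hr8 : r ^ 8 = 1 := by rw [← hr]; exact pow_orderOf_eq_one r
    -- `c = r⁴`
    have hcr : c ∈ Subgroup.zpowers r := by
      by_contra hnot
      exact hab (comm_of_orderOf_eq_eight hcard r c hr hnot (hcz r).symm a b)
    have hr4 : r ^ 4 = c := hinv8 r hr hcr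
    have hr4eq : r ^ 4 = (r * r) * (r * r) := by rw [show (4 : ℕ) = 2 + 2 by norm_num, pow_add, pow_two]
    -- some `s ∉ ⟨r⟩`
    obtain ⟨s₀, hs₀⟩ : ∃ s : K ≃ₐ[ℚ] K, s ∉ Subgroup.zpowers r := by
      by_contra hall
      simp only [not_exists, not_not] at hall
      have htop : Subgroup.zpowers r = ⊤ := (Subgroup.eq_top_iff' _).2 hall
      have h := Nat.card_zpowers r
      rw [htop, Subgroup.card_top, hcard, hr] at h
      norm_num at h
    obtain ⟨hwords, μ, τ, hμ, hτ, hsr, hss, hodd, hμτ⟩ := structure_of_orderOf_eq_eight hcard r s₀ hr hs₀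
    have hμτ' : μ % 8 * (τ % 8) % 8 = τ := by rw [← Nat.mul_mod]; exact hμτ
    -- `μ ∈ {1, 3, 5, 7}`
    rcases (show μ = 1 ∨ μ = 3 ∨ μ = 5 ∨ μ = 7 by omega) with rfl | rfl | rfl | rfl
    · -- `μ = 1`: commutative
      rw [pow_one] at hsr
      exact absurd (comm_of_orderOf_eq_eight hcard r s₀ hr hs₀ hsr a b) hab
    · -- `μ = 3`: `SD₁₆`; `τ ∈ {0, 4}`; move to `τ = 4`
      obtain ⟨s, hs, hsr3, hss4⟩ : ∃ s : K ≃ₐ[ℚ] K, s ∉ Subgroup.zpowers r ∧ s * r = r ^ 3 * s ∧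
          s * s = r ^ 4 := by
        rcases (show τ = 0 ∨ τ = 4 by omega) with rfl | rfl
        · rw [pow_zero] at hss
          obtain ⟨h1, h2⟩ := shift_s r s₀ 3 hr8 hsr hss
          have hs' : s₀ * r ∉ Subgroup.zpowers r := fun h =>
            hs₀ ((Subgroup.mul_mem_cancel_right _ (Subgroup.mem_zpowers r)).1 h)
          exact ⟨s₀ * r, hs', h1, h2⟩
        · exact ⟨s₀, hs₀, hsr, hss⟩
      obtain ⟨e, hmul, her, -, he1⟩ := exists_table_lawA r s 3 4 hr hs hsr3 hss4 hcard
        (fun p q : ZMod 8 × ZMod 2 => (p.1 + (if p.2 = 0 then q.1 else 3 * q.1 + (if q.2 = 0 then 0 else 4)),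
          p.2 + q.2)) (by decide +kernel) (by decide +kernel) (by decide +kernel) (by decide +kernel)
          (by decide +kernel) (by decide +kernel)
      have hc' : e c = (4, 0) := by rw [← hr4, hr4eq, hmul, hmul, her]; decide
      exact primdeg_of_exists (exists_simple_degenerate_a34 e hmul hc' he1) φ₀
    · -- `μ = 5`: `M₁₆`; `τ` even; move `τ = 0` to `τ = 6`
      obtain ⟨s, hs, hsr5, τ', hτ', hss'⟩ : ∃ s : K ≃ₐ[ℚ] K, s ∉ Subgroup.zpowers r ∧ s * r = r ^ 5 * s ∧
          ∃ τ' : ℕ, (τ' = 2 ∨ τ' = 4 ∨ τ' = 6) ∧ s * s = r ^ τ' := by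
        rcases (show τ = 0 ∨ τ = 2 ∨ τ = 4 ∨ τ = 6 by omega) with rfl | h
        · rw [pow_zero] at hss
          obtain ⟨h1, h2⟩ := shift_s r s₀ 5 hr8 hsr hss
          have hs' : s₀ * r ∉ Subgroup.zpowers r := fun h =>
            hs₀ ((Subgroup.mul_mem_cancel_right _ (Subgroup.mem_zpowers r)).1 h)
          exact ⟨s₀ * r, hs', h1, 6, Or.inr (Or.inr rfl), h2⟩
        · exact ⟨s₀, hs₀, hsr, τ, h, hss⟩
      rcases hτ' with rfl | rfl | rfl
      · obtain ⟨e, hmul, her, -, he1⟩ := exists_table_lawA r s 5 2 hr hs hsr5 hss' hcard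
          (fun p q : ZMod 8 × ZMod 2 => (p.1 + (if p.2 = 0 then q.1 else 5 * q.1 + (if q.2 = 0 then 0 else 2)),
            p.2 + q.2)) (by decide +kernel) (by decide +kernel) (by decide +kernel) (by decide +kernel)
          (by decide +kernel) (by decide +kernel)
        have hc' : e c = (4, 0) := by rw [← hr4, hr4eq, hmul, hmul, her]; decide
        exact primdeg_of_exists (exists_simple_degenerate_a52 e hmul hc' he1) φ₀
      · obtain ⟨e, hmul, her, -, he1⟩ := exists_table_lawA r s 5 4 hr hs hsr5 hss' hcard
          (fun p q : ZMod 8 × ZMod 2 => (p.1 + (if p.2 = 0 then q.1 else 5 * q.1 + (if q.2 = 0 then 0 else 4)),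
            p.2 + q.2)) (by decide +kernel) (by decide +kernel) (by decide +kernel) (by decide +kernel)
          (by decide +kernel) (by decide +kernel)
        have hc' : e c = (4, 0) := by rw [← hr4, hr4eq, hmul, hmul, her]; decide
        exact primdeg_of_exists (exists_simple_degenerate_a54 e hmul hc' he1) φ₀
      · obtain ⟨e, hmul, her, -, he1⟩ := exists_table_lawA r s 5 6 hr hs hsr5 hss' hcard
          (fun p q : ZMod 8 × ZMod 2 => (p.1 + (if p.2 = 0 then q.1 else 5 * q.1 + (if q.2 = 0 then 0 else 6)),
            p.2 + q.2)) (by decide +kernel) (by decide +kernel) (by decide +kernel) (by decide +kernel)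
          (by decide +kernel) (by decide +kernel)
        have hc' : e c = (4, 0) := by rw [← hr4, hr4eq, hmul, hmul, her]; decide
        exact primdeg_of_exists (exists_simple_degenerate_a56 e hmul hc' he1) φ₀
    · -- `μ = 7`: dihedral/quaternion type is GOOD — contradiction
      exfalso
      apply hng
      right
      refine ⟨r, hr, hr4, fun g => ?_⟩
      have hinv : r⁻¹ = r ^ 7 := inv_eq_of_mul_eq_one_right (by rw [← pow_succ', hr8])
      have hconj : s₀ * r * s₀⁻¹ = r⁻¹ := by rw [mul_inv_eq_iff_eq_mul, hsr, hinv]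
      obtain ⟨i, -, rfl | rfl⟩ := hwords g
      · exact Or.inl (by rw [(Commute.pow_left (Commute.refl r) i).eq, mul_inv_cancel_right])
      · right
        calc r ^ i * s₀ * r * (r ^ i * s₀)⁻¹ = r ^ i * (s₀ * r * s₀⁻¹) * (r ^ i)⁻¹ := by group
          _ = r⁻¹ := by rw [hconj]; group
  · -- exponent `4`
    have h4 : ∀ u : K ≃ₐ[ℚ] K, u ^ 4 = 1 := pow_four_eq_one_of_no_eight hcard h8 a b hab
    obtain ⟨g, hg1, hgc⟩ : ∃ g : K ≃ₐ[ℚ] K, g * g ≠ 1 ∧ g * g ≠ c := by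
      by_contra hall
      simp only [not_exists, not_and, not_not] at hall
      exact hng (Or.inl fun g => by by_cases h : g * g = 1; exact Or.inl h; exact Or.inr (hall g h))
    obtain ⟨s, a₁, b₁, a₂, b₂, ha₁, hb₁, ha₂, hb₂, hg, hcg, hs, hsc, hsg, hss, hodd, hne, heven⟩ :=
      structure_of_pow_four hcard c hc1 hcc hcz h4 a b hab g hg1 hgc
    have hgc' : g * c = c * g := hcz g
    -- the twelve law-E cases
    rcases (show a₁ = 1 ∨ a₁ = 3 by omega) with rfl | rfl <;>
      rcases (show b₁ = 0 ∨ b₁ = 1 by omega) with rfl | rfl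
    · exact absurd ⟨rfl, rfl⟩ hne
    · -- `(1,1)`
      rcases (show a₂ = 0 ∨ a₂ = 2 by omega) with rfl | rfl <;> rcases (show b₂ = 0 ∨ b₂ = 1 by omega) with rfl | rfl
      · obtain ⟨e, hmul, -, hec, -, he1⟩ := exists_table_lawE g c s 1 0 1 0 hg hcg hs hcc hgc' hsc hsg hss hcard
          (by decide +kernel) (by decide +kernel)
        exact primdeg_of_exists (exists_simple_degenerate_e1100 e hmul hec he1) φ₀
      · obtain ⟨e, hmul, -, hec, -, he1⟩ := exists_table_lawE g c s 1 0 1 1 hg hcg hs hcc hgc' hsc hsg hss hcard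
          (by decide +kernel) (by decide +kernel)
        exact primdeg_of_exists (exists_simple_degenerate_e1101 e hmul hec he1) φ₀
      · obtain ⟨e, hmul, -, hec, -, he1⟩ := exists_table_lawE g c s 1 2 1 0 hg hcg hs hcc hgc' hsc hsg hss hcard
          (by decide +kernel) (by decide +kernel)
        exact primdeg_of_exists (exists_simple_degenerate_e1120 e hmul hec he1) φ₀
      · obtain ⟨e, hmul, -, hec, -, he1⟩ := exists_table_lawE g c s 1 2 1 1 hg hcg hs hcc hgc' hsc hsg hss hcard
          (by decide +kernel) (by decide +kernel)
        exact primdeg_of_exists (exists_simple_degenerate_e1121 e hmul hec he1) φ₀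
    · -- `(3,0)`
      rcases (show a₂ = 0 ∨ a₂ = 2 by omega) with rfl | rfl <;> rcases (show b₂ = 0 ∨ b₂ = 1 by omega) with rfl | rfl
      · obtain ⟨e, hmul, -, hec, -, he1⟩ := exists_table_lawE g c s 3 0 0 0 hg hcg hs hcc hgc' hsc hsg hss hcard
          (by decide +kernel) (by decide +kernel)
        exact primdeg_of_exists (exists_simple_degenerate_e3000 e hmul hec he1) φ₀
      · obtain ⟨e, hmul, -, hec, -, he1⟩ := exists_table_lawE g c s 3 0 0 1 hg hcg hs hcc hgc' hsc hsg hss hcard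
          (by decide +kernel) (by decide +kernel)
        exact primdeg_of_exists (exists_simple_degenerate_e3001 e hmul hec he1) φ₀
      · obtain ⟨e, hmul, -, hec, -, he1⟩ := exists_table_lawE g c s 3 2 0 0 hg hcg hs hcc hgc' hsc hsg hss hcard
          (by decide +kernel) (by decide +kernel)
        exact primdeg_of_exists (exists_simple_degenerate_e3020 e hmul hec he1) φ₀
      · obtain ⟨e, hmul, -, hec, -, he1⟩ := exists_table_lawE g c s 3 2 0 1 hg hcg hs hcc hgc' hsc hsg hss hcard
          (by decide +kernel) (by decide +kernel)
        exact primdeg_of_exists (exists_simple_degenerate_e3021 e hmul hec he1) φ₀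
    · -- `(3,1)`
      rcases (show a₂ = 0 ∨ a₂ = 2 by omega) with rfl | rfl <;> rcases (show b₂ = 0 ∨ b₂ = 1 by omega) with rfl | rfl
      · obtain ⟨e, hmul, -, hec, -, he1⟩ := exists_table_lawE g c s 3 0 1 0 hg hcg hs hcc hgc' hsc hsg hss hcard
          (by decide +kernel) (by decide +kernel)
        exact primdeg_of_exists (exists_simple_degenerate_e3100 e hmul hec he1) φ₀
      · obtain ⟨e, hmul, -, hec, -, he1⟩ := exists_table_lawE g c s 3 0 1 1 hg hcg hs hcc hgc' hsc hsg hss hcard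
          (by decide +kernel) (by decide +kernel)
        exact primdeg_of_exists (exists_simple_degenerate_e3101 e hmul hec he1) φ₀
      · obtain ⟨e, hmul, -, hec, -, he1⟩ := exists_table_lawE g c s 3 2 1 0 hg hcg hs hcc hgc' hsc hsg hss hcard
          (by decide +kernel) (by decide +kernel)
        exact primdeg_of_exists (exists_simple_degenerate_e3120 e hmul hec he1) φ₀
      · obtain ⟨e, hmul, -, hec, -, he1⟩ := exists_table_lawE g c s 3 2 1 1 hg hcg hs hcc hgc' hsc hsg hss hcard
          (by decide +kernel) (by decide +kernel)
        exact primdeg_of_exists (exists_simple_degenerate_e3121 e hmul hec he1) φ₀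

/-! ## §3 The classification -/

/-- **THE CLASSIFICATION (CM types).**  For a Galois CM field `K` of degree `16` with group `G` and complex
conjugation `c`: every primitive CM type of `K` is nondegenerate **iff** `GOOD16(G, c)` — every `g` satisfies
`g² ∈ {1, c}`, or some `r` of order `8` has `r⁴ = c` and all its conjugates in `{r, r⁻¹}`.
[cite: Dodson1987, §1.1 (p. 50)] [cite: Shimura1998, §8.2 Prop. 26] [cite: Gordon1999HodgeAVSurvey, Thm. 6.4] -/
theorem forall_isPrimitive_isNondegenerate_iff_good16 (hK : Module.finrank ℚ K = 16) (φ₀ : K →+* ℂ) :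
    (∀ Φ : CMType K, IsPrimitive (ℂ ≃+* ℂ) Φ.1 φ₀ → IsNondegenerate Φ) ↔
    ((∀ g : K ≃ₐ[ℚ] K, g * g = 1 ∨ g * g = (IsCMField.complexConj K).restrictScalars ℚ) ∨
      (∃ r : K ≃ₐ[ℚ] K, orderOf r = 8 ∧ r ^ 4 = (IsCMField.complexConj K).restrictScalars ℚ ∧
        ∀ g : K ≃ₐ[ℚ] K, g * r * g⁻¹ = r ∨ g * r * g⁻¹ = r⁻¹)) := by
  constructor
  · intro h
    by_contra hng
    obtain ⟨Φ, hprim, hdeg⟩ := exists_isPrimitive_not_isNondegenerate_of_not_good16 hK hng φ₀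
    exact hdeg (h Φ hprim)
  · intro hgood Φ hprim
    exact isNondegenerate_of_isPrimitive_of_good16 hK hgood φ₀ hprim

section Geometry

variable {A : AbelianVariety ℂ}

/-- **THE CLASSIFICATION (simple abelian varieties).**  For a Galois CM field `K` of degree `16`: every SIMPLE
abelian variety with complex multiplication by `K` (through some CM type read on `H¹`) is NONDEGENERATE — so that the
Hodge conjecture holds for all its powers with `Hdg = Div` — **iff** `GOOD16(Gal(K/ℚ), c)`.
[cite: Shimura1998, §6.2 Thm. 3 and §8.2 Prop. 26] [cite: Gordon1999HodgeAVSurvey, Thm. 6.4] -/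
theorem forall_isSimple_isNondegenerate_iff_good16 (hK : Module.finrank ℚ K = 16) :
    (∀ (Φ : CMType K) (A : AbelianVariety ℂ) (ι : 𝓞 K →+* End A)
        (θ : K →+* Module.End ℂ (complexBetti A.X 1)), IsCMTypeRealisation Φ A ι θ → A.IsSimple →
        IsNondegenerate Φ) ↔
    ((∀ g : K ≃ₐ[ℚ] K, g * g = 1 ∨ g * g = (IsCMField.complexConj K).restrictScalars ℚ) ∨
      (∃ r : K ≃ₐ[ℚ] K, orderOf r = 8 ∧ r ^ 4 = (IsCMField.complexConj K).restrictScalars ℚ ∧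
        ∀ g : K ≃ₐ[ℚ] K, g * r * g⁻¹ = r ∨ g * r * g⁻¹ = r⁻¹)) := by
  obtain ⟨φ₀⟩ := (inferInstance : Nonempty (K →+* ℂ))
  rw [← forall_isPrimitive_isNondegenerate_iff_good16 hK φ₀]
  constructor
  · intro h Φ hprim
    obtain ⟨A, ι, θ, hA, hs, -⟩ := AbelianSixteen.exists_simple_realisation_of_isPrimitive Φ φ₀ hprim
    exact h Φ A ι θ hA hs
  · intro h Φ A ι θ hA hs
    exact h Φ ((isSimple_iff_isPrimitive hA φ₀).1 hs)

/-- **The bad case, geometrically**: if `GOOD16` fails, `K` has a primitive degenerate CM type realised by a SIMPLE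
CM abelian eightfold carrying an exceptional Hodge class — rational, of type `(p,p)`, outside the complexified divisor
ring — on some power. [cite: Shimura1998, §6.2 Thm. 3 and §8.2 Prop. 26] [cite: Gordon1999HodgeAVSurvey, Thm. 6.4] -/
theorem exists_simple_degenerate_of_not_good16 (hK : Module.finrank ℚ K = 16)
    (hng : ¬ ((∀ g : K ≃ₐ[ℚ] K, g * g = 1 ∨ g * g = (IsCMField.complexConj K).restrictScalars ℚ) ∨
      (∃ r : K ≃ₐ[ℚ] K, orderOf r = 8 ∧ r ^ 4 = (IsCMField.complexConj K).restrictScalars ℚ ∧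
        ∀ g : K ≃ₐ[ℚ] K, g * r * g⁻¹ = r ∨ g * r * g⁻¹ = r⁻¹))) :
    ∃ (Φ : CMType K) (φ₀ : K →+* ℂ) (A : AbelianVariety ℂ) (ι : 𝓞 K →+* End A)
      (θ : K →+* Module.End ℂ (complexBetti A.X 1)),
      IsPrimitive (ℂ ≃+* ℂ) Φ.1 φ₀ ∧ ¬ IsNondegenerate Φ ∧ IsCMTypeRealisation Φ A ι θ ∧ A.IsSimple ∧
      A.dim = Module.finrank ℚ K / 2 ∧
      ∃ n p : ℕ, ∃ x : complexBetti (⨁ fun _ : Fin n => A).X (2 * p), IsRationalClass x ∧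
        IsOfHodgeType (⨁ fun _ : Fin n => A).dim (⨁ fun _ : Fin n => A).X (2 * p) p p x ∧
        x ∉ divisorClassesSpan (⨁ fun _ : Fin n => A).X (⨁ fun _ : Fin n => A).dim p := by
  obtain ⟨φ₀⟩ := (inferInstance : Nonempty (K →+* ℂ))
  obtain ⟨Φ, hprim, hdeg⟩ := exists_isPrimitive_not_isNondegenerate_of_not_good16 hK hng φ₀
  obtain ⟨A, ι, θ, hA, hs, hdim⟩ := AbelianSixteen.exists_simple_realisation_of_isPrimitive Φ φ₀ hprim
  exact ⟨Φ, φ₀, A, ι, θ, hprim, hdeg, hA, hs, hdim, exists_exceptional_pow_of_not_isNondegenerate φ₀ hprim hdeg hA⟩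

end Geometry

end Summit.HodgeConjecture.CorCM.GaloisSixteenClassification

end
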